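import Summits.AtomisticToContinuum.HydrodynamicLimit.Theorems.AntiMazurCoboundariesCorrectorPressureDecayTangentBiasOneBodyLimit
import Summits.AtomisticToContinuum.HydrodynamicLimit.Theorems.AntiMazurCoboundariesCorrectorPressureDecayTangentBiasCampbellBound
import Mathlib.MeasureTheory.Measure.Regular

/-!
# Intensity bounds pass to Laplace-functional (vague) limits (line `FirstLemma`, crux stmt-AtomisticToContinuum-14135)

Helper file of crux stmt-AtomisticToContinuum-14135 `AntiMazurCoboundaries.CorrectorPressureDecay`, line `FirstLemma`
(idea `kifer-compactification`), namespace `…Theorems.KiferCompactification`; registered stub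
`stub_intensity_of_laplaceLimit` (hypothesis of (E1), the compactness half of Georgii's equivalence of ensembles):
if the Laplace functionals of probability laws `P k` on `PointConfig (ℝ³ × ℝ³)` converge on `C_c⁺` to those of a
probability law `μ`, and every `P k` has intensity `≤ c · Leb` in the position variable (`c < ∞`), then so does `μ`:
`E_μ N(B × ℝ³) ≤ c · vol B` for every measurable `B ⊆ ℝ³`. Pure point-process measure theory. Route:
* `lintegral_le_of_tendsto_integral_exp`: for measurable `S ≥ 0` with `∫⁻ S dP_k ≤ M` and
  `E_{P k}[e^{-tS}] → E_μ[e^{-tS}]` (`t > 0`): `∫⁻ S dμ ≤ M` (difference quotients `(1 - e^{-tS})/t ≤ S`, whose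
  expectations are `(1 - Laplace)/t`, and Fatou along `t = 1/(n+1) → 0`);
* `lintegral_sumFn_le_of_laplaceLimit`: applied to `S = Σ_ω h`, `h ∈ C_c`, `0 ≤ h ≤ 1_{B × ℝ³}`, `Σ_ω h ≤ N(B × ℝ³)`;
* compact `K ⊆ U × ℝ³` (`U` open) by a Urysohn function `1_K ≤ h ≤ 1_{U × ℝ³}`; open `U` by monotone convergence
  along a compact exhaustion of `U × ℝ³` (`lintegral_count_iUnion_campbell`); measurable `B` by outer regularity.
The finiteness `c ≠ ⊤` is NECESSARY: for `c = ⊤` the hypothesis only says that the intensities of the `P k` are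
Lebesgue-absolutely continuous, which is not preserved under vague limits (uniform points in shrinking balls
converge to a deterministic point).
-/

noncomputable section

open MeasureTheory ProbabilityTheory Set Filter Topology
open scoped ENNReal NNReal

namespace Summit.AtomisticToContinuum.HydrodynamicLimit.Theorems.KiferCompactification

open Literature.MathematicalPhysics.KineticTheory (V3)
open Literature.MathematicalPhysics.KineticTheory.PointProcess (laplaceFunctional)
open Literature.Analysis.FunctionSpaces (PointConfig)
open Literature.Analysis.FunctionSpaces.PointConfig (sumFn_def sumFn_eq_sum sumFn_nonneg finite_inter_support)

/-! ## One-sided expectations from Laplace transforms (Fatou) -/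

/-- For `s ≥ 0 < t`: `0 ≤ (1 - e^{-ts})/t ≤ s`. -/
private theorem laplaceQuot_mem {s t : ℝ} (hs : 0 ≤ s) (ht : 0 < t) :
    0 ≤ (1 - Real.exp (-(t * s))) / t ∧ (1 - Real.exp (-(t * s))) / t ≤ s := by
  -- adapted from …TangentBiasOneBodyLimit.lean (private there)
  refine ⟨div_nonneg (sub_nonneg.2 (Real.exp_le_one_iff.2 (neg_nonpos.2 (by positivity)))) ht.le, ?_⟩
  rw [div_le_iff₀ ht]
  linarith [Real.add_one_le_exp (-(t * s)), mul_comm s t]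

/-- For `s ≥ 0 < t` with `ts ≤ 1`: `|s - (1 - e^{-ts})/t| ≤ t s²`. -/
private theorem abs_sub_laplaceQuot_le {s t : ℝ} (hs : 0 ≤ s) (ht : 0 < t) (hst : t * s ≤ 1) :
    |s - (1 - Real.exp (-(t * s))) / t| ≤ t * s ^ 2 := by
  -- adapted from …TangentBiasOneBodyLimit.lean (private there)
  have h1 : |Real.exp (-(t * s)) - 1 - (-(t * s))| ≤ (-(t * s)) ^ 2 :=
    Real.abs_exp_sub_one_sub_id_le (by rw [abs_neg, abs_of_nonneg (by positivity)]; exact hst)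
  have h2 : s - (1 - Real.exp (-(t * s))) / t = (Real.exp (-(t * s)) - 1 - (-(t * s))) / t := by
    field_simp
    ring
  rw [h2, abs_div, abs_of_pos ht, div_le_iff₀ ht]
  exact h1.trans_eq (by ring)

/-- **One-sided expectations from Laplace transforms.** If `S ≥ 0` is measurable, `∫⁻ S dP_k ≤ M` for the
probability laws `P k`, and `E_{P k}[e^{-tS}] → E_μ[e^{-tS}]` for every `t > 0` (`μ` a probability law), then
`∫⁻ S dμ ≤ M`. With `g_t = (1 - e^{-tS})/t`: `0 ≤ g_t ≤ S`, `E_{P k}[g_t] = (1 - E_{P k}[e^{-tS}])/t → E_μ[g_t]`, so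
`E_μ[g_t] ≤ M`; and `g_{1/(n+1)} → S` pointwise, so Fatou gives `∫⁻ S dμ ≤ liminf E_μ[g_{1/(n+1)}] ≤ M`. -/
theorem lintegral_le_of_tendsto_integral_exp {Ω : Type*} [MeasurableSpace Ω] {P : ℕ → Measure Ω}
    (hP : ∀ k, IsProbabilityMeasure (P k)) {μ : Measure Ω} [IsProbabilityMeasure μ] {S : Ω → ℝ}
    (hS : Measurable S) (hS0 : ∀ ω, 0 ≤ S ω) {M : ℝ≥0∞} (hM : ∀ k, ∫⁻ ω, ENNReal.ofReal (S ω) ∂P k ≤ M)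
    (hL : ∀ t : ℝ, 0 < t →
      Tendsto (fun k => ∫ ω, Real.exp (-(t * S ω)) ∂P k) atTop (𝓝 (∫ ω, Real.exp (-(t * S ω)) ∂μ))) :
    ∫⁻ ω, ENNReal.ofReal (S ω) ∂μ ≤ M := by
  -- the difference quotients `g t = (1 - e^{-tS})/t`
  obtain ⟨g, hg⟩ : ∃ g : ℝ → Ω → ℝ, ∀ t ω, g t ω = (1 - Real.exp (-(t * S ω))) / t := ⟨_, fun _ _ => rfl⟩
  have hem : ∀ t, Measurable fun ω => Real.exp (-(t * S ω)) := fun t => (hS.const_mul t).neg.exp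
  have hgm : ∀ t, Measurable (g t) := fun t => by
    rw [show g t = fun ω => (1 - Real.exp (-(t * S ω))) / t from funext (hg t)]
    exact ((hem t).const_sub 1).div_const t
  have hei : ∀ (ν : Measure Ω) [IsFiniteMeasure ν] (t : ℝ), 0 < t →
      Integrable (fun ω => Real.exp (-(t * S ω))) ν := fun ν _ t ht =>
    Integrable.of_bound (hem t).aestronglyMeasurable 1 (ae_of_all _ fun ω => by
      rw [Real.norm_eq_abs, abs_of_nonneg (Real.exp_pos _).le, Real.exp_le_one_iff, neg_nonpos]
      exact mul_nonneg ht.le (hS0 ω))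
  have hgi : ∀ (ν : Measure Ω) [IsFiniteMeasure ν] (t : ℝ), 0 < t → Integrable (g t) ν := fun ν _ t ht => by
    rw [show g t = fun ω => (1 - Real.exp (-(t * S ω))) / t from funext (hg t)]
    exact ((integrable_const 1).sub (hei ν t ht)).div_const t
  have hgb : ∀ t, 0 < t → ∀ ω, 0 ≤ g t ω ∧ g t ω ≤ S ω := fun t ht ω => by
    rw [hg]; exact laplaceQuot_mem (hS0 ω) ht
  -- integrals of `g t` are `(1 - Laplace transform)/t`
  have hgint : ∀ ν : Measure Ω, IsProbabilityMeasure ν → ∀ t : ℝ, 0 < t →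
      ∫ ω, g t ω ∂ν = (1 - ∫ ω, Real.exp (-(t * S ω)) ∂ν) / t := fun ν _ t ht => by
    simp only [hg]
    rw [integral_div, integral_sub (integrable_const 1) (hei ν t ht), integral_const, probReal_univ, one_smul]
  -- (I) convergence of `E_{P k}[g t]`
  have hI : ∀ t, 0 < t → Tendsto (fun k => ∫ ω, g t ω ∂P k) atTop (𝓝 (∫ ω, g t ω ∂μ)) := fun t ht => by
    rw [hgint μ inferInstance t ht, show (fun k => ∫ ω, g t ω ∂P k) =
      fun k => (1 - ∫ ω, Real.exp (-(t * S ω)) ∂P k) / t from funext fun k => hgint (P k) (hP k) t ht]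
    exact ((hL t ht).const_sub 1).div_const t
  -- (II) the `ℝ≥0∞`-valued integrals of `g t`
  have hII : ∀ (ν : Measure Ω) [IsFiniteMeasure ν] (t : ℝ), 0 < t →
      ∫⁻ ω, ENNReal.ofReal (g t ω) ∂ν = ENNReal.ofReal (∫ ω, g t ω ∂ν) := fun ν _ t ht =>
    (ofReal_integral_eq_lintegral_ofReal (hgi ν t ht) (ae_of_all _ fun ω => (hgb t ht ω).1)).symm
  -- (III) `∫⁻ g t dμ ≤ M`
  have hIII : ∀ t, 0 < t → ∫⁻ ω, ENNReal.ofReal (g t ω) ∂μ ≤ M := fun t ht => by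
    rw [hII μ t ht]
    refine le_of_tendsto' ((ENNReal.continuous_ofReal.tendsto _).comp (hI t ht)) fun k => ?_
    haveI := hP k
    rw [Function.comp_apply, ← hII (P k) t ht]
    exact (lintegral_mono fun ω => ENNReal.ofReal_le_ofReal (hgb t ht ω).2).trans (hM k)
  -- the sequence `t n = 1/(n+1)` and the pointwise convergence `g (t n) → S`
  obtain ⟨t, ht⟩ : ∃ t : ℕ → ℝ, ∀ n, t n = 1 / ((n : ℝ) + 1) := ⟨_, fun _ => rfl⟩
  have htpos : ∀ n, 0 < t n := fun n => by rw [ht]; exact Nat.one_div_pos_of_nat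
  have ht0 : ∀ c : ℝ, Tendsto (fun n => t n * c) atTop (𝓝 0) := fun c => by
    rw [show (0 : ℝ) = 0 * c from (zero_mul c).symm]
    refine Tendsto.mul_const c ?_
    rw [show t = fun n : ℕ => 1 / ((n : ℝ) + 1) from funext ht]
    exact tendsto_one_div_add_atTop_nhds_zero_nat
  have hgpt : ∀ ω, Tendsto (fun n => g (t n) ω) atTop (𝓝 (S ω)) := fun ω => by
    rw [← tendsto_sub_nhds_zero_iff]
    refine squeeze_zero_norm' (((ht0 (S ω)).eventually (eventually_le_nhds one_pos)).mono fun n hn => ?_)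
      (ht0 (S ω ^ 2))
    rw [Real.norm_eq_abs, abs_sub_comm, hg]
    exact abs_sub_laplaceQuot_le (hS0 ω) (htpos n) hn
  -- (IV) Fatou
  rw [show (fun ω => ENNReal.ofReal (S ω)) = fun ω => liminf (fun n => ENNReal.ofReal (g (t n) ω)) atTop from
      funext fun ω => ((ENNReal.tendsto_ofReal (hgpt ω)).liminf_eq).symm]
  calc ∫⁻ ω, liminf (fun n => ENNReal.ofReal (g (t n) ω)) atTop ∂μ
      ≤ liminf (fun n => ∫⁻ ω, ENNReal.ofReal (g (t n) ω) ∂μ) atTop :=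
        lintegral_liminf_le fun n => (hgm (t n)).ennreal_ofReal
    _ ≤ M := liminf_le_of_frequently_le (Frequently.of_forall fun n => hIII (t n) (htpos n))

/-! ## Linear statistics of the limit law -/

/-- Laplace functionals of multiples of a test function: `L_ν(t u) = ∫ exp(-t ∑_{p ∈ ω} u p) dν`. -/
private theorem laplaceFunctional_const_mul (ν : Measure (PointConfig (V3 × V3))) (u : V3 × V3 → ℝ) (t : ℝ) :
    laplaceFunctional ν (fun p => t * u p) = ∫ ω, Real.exp (-(t * ω.sumFn u)) ∂ν := by
  -- adapted from …TangentBiasOneBodyLimit.lean (private there)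
  rw [Literature.MathematicalPhysics.KineticTheory.PointProcess.laplaceFunctional]
  refine integral_congr_ae (ae_of_all _ fun ω => ?_)
  simp only
  rw [sumFn_def, mul_finsum_mem]

/-- A compactly supported test function `0 ≤ h ≤ 1` vanishing off `A` sums, over the points of a configuration, to
at most the number of its points in `A`. -/
theorem ofReal_sumFn_le_toENNReal_count (ω : PointConfig (V3 × V3)) {A : Set (V3 × V3)} {h : V3 × V3 → ℝ}
    (hcs : HasCompactSupport h) (hh1 : ∀ p, h p ≤ 1) (hA : Function.support h ⊆ A) :
    ENNReal.ofReal (ω.sumFn h) ≤ ((ω.count A : ℕ∞) : ℝ≥0∞) := by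
  have hfin := ω.finite_inter_support hcs
  rw [ω.sumFn_eq_sum hcs]
  calc ENNReal.ofReal (∑ p ∈ hfin.toFinset, h p) ≤ ENNReal.ofReal (∑ _p ∈ hfin.toFinset, (1 : ℝ)) :=
        ENNReal.ofReal_le_ofReal (Finset.sum_le_sum fun p _ => hh1 p)
    _ = ((hfin.toFinset.card : ℕ∞) : ℝ≥0∞) := by
        rw [Finset.sum_const, nsmul_eq_mul, mul_one, ENNReal.ofReal_natCast, ENat.toENNReal_coe]
    _ = ((((ω : Set (V3 × V3)) ∩ Function.support h).encard : ℕ∞) : ℝ≥0∞) := by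
        rw [hfin.encard_eq_coe_toFinset_card]
    _ ≤ ((ω.count A : ℕ∞) : ℝ≥0∞) :=
        ENat.toENNReal_le.2 (Set.encard_le_encard (Set.inter_subset_inter_right _ hA))

section Limit

variable {P : ℕ → Measure (PointConfig (V3 × V3))} {μ : Measure (PointConfig (V3 × V3))} {c : ℝ≥0∞}

/-- **Mean linear statistics of the limit law.** If the Laplace functionals of the probability laws `P k` converge on
`C_c⁺` to those of the probability law `μ` and `E_{P k} N(B × ℝ³) ≤ c · vol B` for all measurable `B`, then for
`h ∈ C_c`, `0 ≤ h ≤ 1`, vanishing off `B × ℝ³` (`B` measurable): `∫⁻ (Σ_ω h) dμ ≤ c · vol B`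
(`lintegral_le_of_tendsto_integral_exp` with `S = Σ_ω h ≤ N(B × ℝ³)` and the test functions `t h`). -/
theorem lintegral_sumFn_le_of_laplaceLimit (hP : ∀ k, IsProbabilityMeasure (P k)) [IsProbabilityMeasure μ]
    (hconv : ∀ f : V3 × V3 → ℝ, Continuous f → HasCompactSupport f → (∀ p, 0 ≤ f p) →
      Tendsto (fun k => laplaceFunctional (P k) f) atTop (𝓝 (laplaceFunctional μ f)))
    (hint : ∀ (k : ℕ) (B : Set V3), MeasurableSet B →
      ∫⁻ ω, ((ω.count (Prod.fst ⁻¹' B) : ℕ∞) : ℝ≥0∞) ∂(P k) ≤ c * volume B)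
    {h : V3 × V3 → ℝ} (hh : Continuous h) (hcs : HasCompactSupport h) (hh0 : ∀ p, 0 ≤ h p) (hh1 : ∀ p, h p ≤ 1)
    {B : Set V3} (hB : MeasurableSet B) (hhB : Function.support h ⊆ Prod.fst ⁻¹' B) :
    ∫⁻ ω, ENNReal.ofReal (ω.sumFn h) ∂μ ≤ c * volume B := by
  refine lintegral_le_of_tendsto_integral_exp hP (measurable_sumFn hh.measurable hcs) (fun ω => sumFn_nonneg ω hh0)
    (fun k => (lintegral_mono fun ω => ofReal_sumFn_le_toENNReal_count ω hcs hh1 hhB).trans (hint k B hB))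
    fun t ht => ?_
  have h1 := hconv (fun p => t * h p) (continuous_const.mul hh) hcs.mul_left fun p => mul_nonneg ht.le (hh0 p)
  simp_rw [laplaceFunctional_const_mul] at h1
  exact h1

/-- **Counting compact sets in the limit law.** Under the same hypotheses, for compact `K ⊆ U × ℝ³` with `U ⊆ ℝ³`
open: `E_μ N(K) ≤ c · vol U` (count `K` by a Urysohn function `1_K ≤ h ≤ 1_{U × ℝ³}`, `h ∈ C_c`). -/
theorem lintegral_count_compact_le_of_laplaceLimit (hP : ∀ k, IsProbabilityMeasure (P k)) [IsProbabilityMeasure μ]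
    (hconv : ∀ f : V3 × V3 → ℝ, Continuous f → HasCompactSupport f → (∀ p, 0 ≤ f p) →
      Tendsto (fun k => laplaceFunctional (P k) f) atTop (𝓝 (laplaceFunctional μ f)))
    (hint : ∀ (k : ℕ) (B : Set V3), MeasurableSet B →
      ∫⁻ ω, ((ω.count (Prod.fst ⁻¹' B) : ℕ∞) : ℝ≥0∞) ∂(P k) ≤ c * volume B)
    {K : Set (V3 × V3)} (hK : IsCompact K) {U : Set V3} (hU : IsOpen U) (hKU : K ⊆ Prod.fst ⁻¹' U) :
    ∫⁻ ω, ((ω.count K : ℕ∞) : ℝ≥0∞) ∂μ ≤ c * volume U := by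
  obtain ⟨f, hf1, hf0, hfcs, hf01⟩ := exists_continuous_one_zero_of_isCompact hK
    (hU.preimage continuous_fst).isClosed_compl (disjoint_compl_right_iff_subset.2 hKU)
  have hsupp : Function.support f ⊆ Prod.fst ⁻¹' U := fun p hp => by
    by_contra hpU
    exact hp (hf0 hpU)
  calc ∫⁻ ω, ((ω.count K : ℕ∞) : ℝ≥0∞) ∂μ ≤ ∫⁻ ω, ENNReal.ofReal (ω.sumFn f) ∂μ :=
        lintegral_mono fun ω => toENNReal_count_le_ofReal_sumFn ω hK hfcs (fun p => (hf01 p).1) fun p hp => by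
          rw [hf1 hp, Pi.one_apply]
    _ ≤ c * volume U := lintegral_sumFn_le_of_laplaceLimit hP hconv hint f.continuous hfcs (fun p => (hf01 p).1)
        (fun p => (hf01 p).2) hU.measurableSet hsupp

/-- **Counting open cylinders in the limit law.** Under the same hypotheses, for `U ⊆ ℝ³` open:
`E_μ N(U × ℝ³) ≤ c · vol U` (monotone convergence along the compact exhaustion
`(F_n ∩ B̄(0,n)) × B̄(0,n) ↑ U × ℝ³`, `F_n ↑ U` closed, of `lintegral_count_compact_le_of_laplaceLimit`). -/
theorem lintegral_count_open_le_of_laplaceLimit (hP : ∀ k, IsProbabilityMeasure (P k)) [IsProbabilityMeasure μ]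
    (hconv : ∀ f : V3 × V3 → ℝ, Continuous f → HasCompactSupport f → (∀ p, 0 ≤ f p) →
      Tendsto (fun k => laplaceFunctional (P k) f) atTop (𝓝 (laplaceFunctional μ f)))
    (hint : ∀ (k : ℕ) (B : Set V3), MeasurableSet B →
      ∫⁻ ω, ((ω.count (Prod.fst ⁻¹' B) : ℕ∞) : ℝ≥0∞) ∂(P k) ≤ c * volume B)
    {U : Set V3} (hU : IsOpen U) :
    ∫⁻ ω, ((ω.count (Prod.fst ⁻¹' U) : ℕ∞) : ℝ≥0∞) ∂μ ≤ c * volume U := by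
  obtain ⟨F, hFc, hFU, hFun, hFmono⟩ := hU.exists_iUnion_isClosed
  obtain ⟨A, hA⟩ : ∃ A : ℕ → Set (V3 × V3),
      ∀ n, A n = (F n ∩ Metric.closedBall (0 : V3) n) ×ˢ Metric.closedBall (0 : V3) n := ⟨_, fun _ => rfl⟩
  have hAK : ∀ n, IsCompact (A n) := fun n => by
    rw [hA]
    exact ((isCompact_closedBall (0 : V3) n).inter_left (hFc n)).prod (isCompact_closedBall (0 : V3) n)
  have hAm : ∀ n, MeasurableSet (A n) := fun n => (hAK n).isClosed.measurableSet
  have hAmono : Monotone A := fun m n hmn => by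
    rw [hA, hA]
    have hb : Metric.closedBall (0 : V3) m ⊆ Metric.closedBall (0 : V3) n :=
      Metric.closedBall_subset_closedBall (by exact_mod_cast hmn)
    exact Set.prod_mono (inter_subset_inter (hFmono hmn) hb) hb
  have hAU : ∀ n, A n ⊆ Prod.fst ⁻¹' U := fun n p hp => by
    rw [hA] at hp
    exact hFU n hp.1.1
  have hUA : (⋃ n, A n) = Prod.fst ⁻¹' U := by
    refine Subset.antisymm (iUnion_subset hAU) fun p hp => ?_
    rw [mem_preimage, ← hFun, mem_iUnion] at hp
    obtain ⟨m, hm⟩ := hp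
    obtain ⟨k, hk⟩ := exists_nat_ge (max ‖p.1‖ ‖p.2‖)
    have hk' : max ‖p.1‖ ‖p.2‖ ≤ ((max m k : ℕ) : ℝ) := hk.trans (by exact_mod_cast le_max_right m k)
    refine mem_iUnion.2 ⟨max m k, ?_⟩
    rw [hA, mem_prod, mem_inter_iff, Metric.mem_closedBall, Metric.mem_closedBall, dist_zero_right, dist_zero_right]
    exact ⟨⟨hFmono (le_max_left _ _) hm, (le_max_left _ _).trans hk'⟩, (le_max_right _ _).trans hk'⟩
  rw [← hUA, lintegral_count_iUnion_campbell μ hAm hAmono]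
  exact iSup_le fun n => lintegral_count_compact_le_of_laplaceLimit hP hconv hint (hAK n) hU (hAU n)

end Limit

/-- **INTENSITY BOUNDS PASS TO LAPLACE-FUNCTIONAL LIMITS** (registered stub `stub_intensity_of_laplaceLimit` of line
`FirstLemma`, crux stmt-AtomisticToContinuum-14135; hypothesis of the compactness half (E1) of Georgii's equivalence
of ensembles). If the Laplace functionals of probability laws `P k` on configurations in `ℝ³ × ℝ³` converge on
`C_c⁺` to those of a probability law `μ`, and `E_{P k} N(B × ℝ³) ≤ c · vol B` for all `k` and all measurable `B`
with `c < ∞`, then `E_μ N(B × ℝ³) ≤ c · vol B` for all measurable `B` (open `B`: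
`lintegral_count_open_le_of_laplaceLimit`; measurable `B`: outer regularity of Lebesgue measure). -/
theorem stub_intensity_of_laplaceLimit :
    ∀ (P : ℕ → Measure (PointConfig (V3 × V3))) (μ : Measure (PointConfig (V3 × V3))) (c : ℝ≥0∞),
      (∀ k, IsProbabilityMeasure (P k)) → IsProbabilityMeasure μ → c ≠ ⊤ →
      (∀ f : V3 × V3 → ℝ, Continuous f → HasCompactSupport f → (∀ p, 0 ≤ f p) →
        Tendsto (fun k => laplaceFunctional (P k) f) atTop (𝓝 (laplaceFunctional μ f))) →
      (∀ (k : ℕ) (B : Set V3), MeasurableSet B →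
        ∫⁻ ω, ((ω.count (Prod.fst ⁻¹' B) : ℕ∞) : ℝ≥0∞) ∂(P k) ≤ c * volume B) →
      ∀ B : Set V3, MeasurableSet B → ∫⁻ ω, ((ω.count (Prod.fst ⁻¹' B) : ℕ∞) : ℝ≥0∞) ∂μ ≤ c * volume B := by
  intro P μ c hP hμ hc hconv hint B _hB
  have hmono : ∀ {T U : Set V3}, T ⊆ U → ∫⁻ ω, ((ω.count (Prod.fst ⁻¹' T) : ℕ∞) : ℝ≥0∞) ∂μ ≤
      ∫⁻ ω, ((ω.count (Prod.fst ⁻¹' U) : ℕ∞) : ℝ≥0∞) ∂μ := fun hTU =>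
    lintegral_mono fun ω => ENat.toENNReal_le.2 (ω.count_mono (preimage_mono hTU))
  refine le_of_forall_gt_imp_ge_of_dense fun r hr => ?_
  obtain ⟨U, hBU, hUo, hUr⟩ : ∃ U : Set V3, B ⊆ U ∧ IsOpen U ∧ c * volume U < r := by
    by_cases hC : c = 0
    · refine ⟨univ, subset_univ _, isOpen_univ, ?_⟩
      rw [hC, zero_mul]
      exact lt_of_le_of_lt bot_le hr
    · have h1 : volume B < r / c := by
        rw [ENNReal.lt_div_iff_mul_lt (Or.inl hC) (Or.inl hc), mul_comm]
        exact hr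
      obtain ⟨U, hUB, hUo, hU⟩ := Set.exists_isOpen_lt_of_lt B _ h1
      refine ⟨U, hUB, hUo, ?_⟩
      rw [ENNReal.lt_div_iff_mul_lt (Or.inl hC) (Or.inl hc), mul_comm] at hU
      exact hU
  exact (hmono hBU).trans ((lintegral_count_open_le_of_laplaceLimit hP hconv hint hUo).trans hUr.le)

end Summit.AtomisticToContinuum.HydrodynamicLimit.Theorems.KiferCompactification
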